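import Literature.Analysis.FunctionSpaces.LatticeEllipticEstimate
import HarnessLib

/-!
# Composition of first-order periodic operators; sums; symbols (Warner 6.24, 6.28), on the lattice

Continuation of `LatticeDiffOp.lean`. The second-order operators met in the elliptic theory of the
Laplacians `Δ = δd + dδ`, `Δ_∂̄ = ∂̄*∂̄ + ∂̄∂̄*` are sums of compositions of first-order operators.
This file provides, for the lattice normal forms `Lattice.POp1` (order `≤ 1`) and `Lattice.POp`
(order `≤ 2`):

* `Lattice.POp1.comp P Q : POp` — the **composition** `P ∘ Q` of two first-order operators,
  computed symbolically by the Leibniz rule (Warner 6.24; the coefficients of `PQ` are the products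
  and first derivatives of those of `P`, `Q`), with `(P.comp Q).apply u = P.apply (Q.apply u)` for
  tempered `u` (`Lattice.POp1.apply_comp`);
* `Lattice.POp.add` — the sum of two second-order operators (`apply_add_op`);
* the **principal symbols**: `Lattice.POp1.symbol P k = ∑_j k_j P_j` and
  `(P.comp Q).symbol k = P.symbol k ∘ Q.symbol k`, `(L + L').symbol = L.symbol + L'.symbol`
  (Warner 6.28: the symbol of a product is the product of the symbols);
* propagation of the smallness of the principal perturbation through composition
  (`Lattice.POp1.principalPerturbationLE_comp`): if `‖p_i ⋆ c‖_0 ≤ ε_P‖c‖_0` and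
  `‖q_j ⋆ c‖_0 ≤ ε_Q‖c‖_0` then the perturbation symbols of `P ∘ Q` have `H_0` operator norm
  `≤ ‖P‖ε_Q + ε_P‖Q‖ + ε_Pε_Q`.

## References

* F. W. Warner, *Foundations of Differentiable Manifolds and Lie Groups*, GTM 94 (1983), 6.24,
  6.28 (ellipticity is a condition on the highest-order part; symbol of a product). [WarnerGTM94]
-/

open Filter Finset
open scoped ENNReal NNReal Topology

noncomputable section

namespace Literature.Analysis.FunctionSpaces

namespace Lattice

open Torus

variable {d : Type*} [Fintype d]
variable {V W X : Type*} [NormedAddCommGroup V] [NormedSpace ℂ V] [NormedAddCommGroup W]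
  [NormedSpace ℂ W] [NormedAddCommGroup X] [NormedSpace ℂ X]

/-! ### Composing a symbol with a constant map on either side -/

/-- `(T ∘ a)(k) = T ∘ a(k)`: a constant map composed on the left of a symbol. [folklore] -/
def compLeft (T : W →L[ℂ] X) (a : (d → ℤ) → (V →L[ℂ] W)) : (d → ℤ) → (V →L[ℂ] X) := fun k => T.comp (a k)

/-- `(a ∘ T)(k) = a(k) ∘ T`: a constant map composed on the right of a symbol. [folklore] -/
def compRight (a : (d → ℤ) → (W →L[ℂ] X)) (T : V →L[ℂ] W) : (d → ℤ) → (V →L[ℂ] X) := fun k => (a k).comp T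

omit [Fintype d] in
/-- Unfolding of `compLeft`. [folklore] -/
@[simp] theorem compLeft_apply (T : W →L[ℂ] X) (a : (d → ℤ) → (V →L[ℂ] W)) (k : d → ℤ) :
    compLeft T a k = T.comp (a k) := rfl

omit [Fintype d] in
/-- Unfolding of `compRight`. [folklore] -/
@[simp] theorem compRight_apply (a : (d → ℤ) → (W →L[ℂ] X)) (T : V →L[ℂ] W) (k : d → ℤ) :
    compRight a T k = (a k).comp T := rfl

omit [NormedSpace ℂ V] [NormedSpace ℂ W] in
/-- Domination across value spaces: if `‖c' k‖ ≤ C ‖c k‖` for all `k` and `c` is rapidly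
decreasing, so is `c'` (the two families may take values in different spaces). [folklore] -/
theorem _root_.Literature.Analysis.FunctionSpaces.Torus.RapidDecay.of_norm_le_mul' {c : (d → ℤ) → V}
    (hc : RapidDecay c) {c' : (d → ℤ) → W} {C : ℝ} (h : ∀ k, ‖c' k‖ ≤ C * ‖c k‖) : RapidDecay c' := by
  intro m
  refine Summable.of_nonneg_of_le (fun k => mul_nonneg (one_add_freqNormSq_pow_nonneg k m) (norm_nonneg _))
    (fun k => ?_) ((hc m).mul_left |C|)
  calc (1 + freqNormSq k) ^ m * ‖c' k‖ ≤ (1 + freqNormSq k) ^ m * (C * ‖c k‖) :=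
        mul_le_mul_of_nonneg_left (h k) (one_add_freqNormSq_pow_nonneg k m)
    _ ≤ (1 + freqNormSq k) ^ m * (|C| * ‖c k‖) :=
        mul_le_mul_of_nonneg_left (mul_le_mul_of_nonneg_right (le_abs_self C) (norm_nonneg _))
          (one_add_freqNormSq_pow_nonneg k m)
    _ = |C| * ((1 + freqNormSq k) ^ m * ‖c k‖) := by ring

/-- `compLeft` preserves rapid decrease. [folklore] -/
theorem _root_.Literature.Analysis.FunctionSpaces.Torus.RapidDecay.compLeft (T : W →L[ℂ] X)
    {a : (d → ℤ) → (V →L[ℂ] W)} (ha : RapidDecay a) : RapidDecay (Lattice.compLeft T a) :=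
  ha.of_norm_le_mul' (C := ‖T‖) fun _ => ContinuousLinearMap.opNorm_comp_le _ _

/-- `compRight` preserves rapid decrease. [folklore] -/
theorem _root_.Literature.Analysis.FunctionSpaces.Torus.RapidDecay.compRight {a : (d → ℤ) → (W →L[ℂ] X)}
    (ha : RapidDecay a) (T : V →L[ℂ] W) : RapidDecay (Lattice.compRight a T) :=
  ha.of_norm_le_mul' (C := ‖T‖) fun k => by
    rw [Lattice.compRight_apply, mul_comm]; exact ContinuousLinearMap.opNorm_comp_le _ _

/-- `T ∘ (a ⋆ c) = (T ∘ a) ⋆ c` for tempered `c` (a continuous linear map passes through the sum).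
[folklore] -/
theorem comp_conv [CompleteSpace W] [CompleteSpace X] (T : W →L[ℂ] X) {a : (d → ℤ) → (V →L[ℂ] W)}
    (ha : RapidDecay a) {c : (d → ℤ) → V} (hc : Tempered c) :
    (fun k => T (conv a c k)) = conv (compLeft T a) c := by
  funext k
  rw [conv_apply, conv_apply, T.map_tsum (summable_conv_term ha hc k)]
  rfl

omit [Fintype d] in
/-- `a ⋆ (T ∘ c) = (a ∘ T) ⋆ c` (definitionally). [folklore] -/
theorem conv_comp (a : (d → ℤ) → (W →L[ℂ] X)) (T : V →L[ℂ] W) (c : (d → ℤ) → V) :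
    conv a (fun k => T (c k)) = conv (compRight a T) c := by
  funext k; rfl

omit [Fintype d] in
/-- Derivatives of `compLeft`: `∂_j (T ∘ a) = T ∘ ∂_j a`. [folklore] -/
theorem freqDeriv_compLeft (T : W →L[ℂ] X) (a : (d → ℤ) → (V →L[ℂ] W)) (j : d) :
    freqDeriv j (compLeft T a) = compLeft T (freqDeriv j a) := by
  funext k; simp [compLeft]

/-! ### Sums of second-order operators -/

namespace POp

/-- The sum of two second-order operators (all coefficients added). [folklore] -/
def add (L L' : POp d V W) : POp d V W where
  A := fun i j => L.A i j + L'.A i j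
  b := fun i j => L.b i j + L'.b i j
  c1 := fun j => L.c1 j + L'.c1 j
  c0 := L.c0 + L'.c0
  hb := fun i j => (L.hb i j).add (L'.hb i j)
  hc1 := fun j => (L.hc1 j).add (L'.hc1 j)
  hc0 := L.hc0.add L'.hc0

variable [CompleteSpace W]

/-- `(L + L') u = L u + L' u` for tempered `u`. [folklore] -/
theorem apply_add_op (L L' : POp d V W) {u : (d → ℤ) → V} (hu : Tempered u) :
    (L.add L').apply u = L.apply u + L'.apply u := by
  have hp : (L.add L').principal u = L.principal u + L'.principal u := by
    funext k
    simp only [principal, add, Pi.add_apply, _root_.add_apply, Finset.sum_add_distrib]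
  have hl : (L.add L').lower u = L.lower u + L'.lower u := by
    rw [lower_def, lower_def, lower_def]
    simp only [add, add_conv L.hc0 L'.hc0 hu, fun j => add_conv (L.hc1 j) (L'.hc1 j) (hu.freqDeriv j),
      fun i j => add_conv (L.hb i j) (L'.hb i j) (hu.freqDeriv_freqDeriv i j), Finset.sum_add_distrib]
    abel
  rw [apply_def, apply_def, apply_def, hp, hl]
  abel

omit [CompleteSpace W] in
/-- The symbol of a sum is the sum of the symbols. [cite: WarnerGTM94, 6.28] -/
theorem symbol_add (L L' : POp d V V) (k : d → ℤ) : (L.add L').symbol k = L.symbol k + L'.symbol k := by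
  simp only [symbol, add, smul_add, Finset.sum_add_distrib]

end POp

omit [NormedSpace ℂ V] in
/-- Rapid decrease of finite sums of families. [folklore] -/
theorem _root_.Literature.Analysis.FunctionSpaces.Torus.RapidDecay.finset_sum
    {ι : Type*} (F : Finset ι) {a : ι → (d → ℤ) → V} (h : ∀ i ∈ F, RapidDecay (a i)) :
    RapidDecay (∑ i ∈ F, a i) := by
  classical
  induction F using Finset.induction_on with
  | empty => simpa using rapidDecay_zero
  | insert i F hi ih =>
      rw [Finset.sum_insert hi]
      exact (h i (Finset.mem_insert_self i F)).add (ih fun k hk => h k (Finset.mem_insert_of_mem hk))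

section FinsetSum

variable [CompleteSpace X]

/-- Convolution by a finite sum of rapidly decreasing symbols. [folklore] -/
theorem finset_sum_conv {ι : Type*} (F : Finset ι) {a : ι → (d → ℤ) → (V →L[ℂ] X)}
    (ha : ∀ i ∈ F, RapidDecay (a i)) {c : (d → ℤ) → V} (hc : Tempered c) :
    conv (∑ i ∈ F, a i) c = ∑ i ∈ F, conv (a i) c := by
  classical
  induction F using Finset.induction_on with
  | empty => simp
  | insert i F hi ih =>
      rw [Finset.sum_insert hi, Finset.sum_insert hi,
        add_conv (ha i (Finset.mem_insert_self i F)) (RapidDecay.finset_sum F fun k hk =>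
          ha k (Finset.mem_insert_of_mem hk)) hc, ih fun k hk => ha k (Finset.mem_insert_of_mem hk)]

/-- Convolution of a finite sum of tempered families. [folklore] -/
theorem conv_finset_sum {ι : Type*} (F : Finset ι) {a : (d → ℤ) → (V →L[ℂ] X)} (ha : RapidDecay a)
    {c : ι → (d → ℤ) → V} (hc : ∀ i ∈ F, Tempered (c i)) :
    conv a (∑ i ∈ F, c i) = ∑ i ∈ F, conv a (c i) := by
  classical
  induction F using Finset.induction_on with
  | empty => simp
  | insert i F hi ih =>
      rw [Finset.sum_insert hi, Finset.sum_insert hi,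
        conv_add ha (hc i (Finset.mem_insert_self i F)) (Tempered.finset_sum F fun k hk =>
          hc k (Finset.mem_insert_of_mem hk)), ih fun k hk => hc k (Finset.mem_insert_of_mem hk)]

end FinsetSum

/-! ### Composition of two first-order operators -/

namespace POp1

/-- The **principal symbol** of a first-order operator, `σ_P(k) = ∑_j k_j P_j`. [cite: WarnerGTM94, 6.28] -/
def symbol (P : POp1 d V W) (k : d → ℤ) : V →L[ℂ] W := ∑ j, (k j : ℂ) • P.P j

variable (P : POp1 d W X) (Q : POp1 d V W)

/-- **Composition of first-order operators** (Warner 6.24: the product of periodic differential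
operators, coefficients computed by the Leibniz rule). With `P u = ∑ (P_i + p_i ⋆) ∂_i u + p₀ ⋆ u`
and `Q u = ∑ (Q_j + q_j ⋆) ∂_j u + q₀ ⋆ u`:
* frozen part `A_{ij} = P_i ∘ Q_j`;
* principal perturbation `b_{ij} = P_i ∘ q_j + p_i ∘ Q_j + p_i ⋆ q_j`;
* first order `c_j = ∑_i (P_i ∘ ∂_i q_j + p_i ⋆ ∂_i q_j) + P_j ∘ q₀ + p_j ⋆ q₀ + p₀ ∘ Q_j + p₀ ⋆ q_j`;
* order zero `c₀ = ∑_i (P_i ∘ ∂_i q₀ + p_i ⋆ ∂_i q₀) + p₀ ⋆ q₀`.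
[cite: WarnerGTM94, 6.24] -/
def comp : POp d V X where
  A := fun i j => (P.P i).comp (Q.P j)
  b := fun i j => compLeft (P.P i) (Q.p j) + compRight (P.p i) (Q.P j) + sconv (P.p i) (Q.p j)
  c1 := fun j => ∑ i, (compLeft (P.P i) (freqDeriv i (Q.p j)) + sconv (P.p i) (freqDeriv i (Q.p j))) +
    (compLeft (P.P j) Q.p0 + sconv (P.p j) Q.p0) + (compRight P.p0 (Q.P j) + sconv P.p0 (Q.p j))
  c0 := ∑ i, (compLeft (P.P i) (freqDeriv i Q.p0) + sconv (P.p i) (freqDeriv i Q.p0)) + sconv P.p0 Q.p0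
  hb := fun i j => (((Q.hp j).compLeft _).add ((P.hp i).compRight _)).add ((P.hp i).sconv (Q.hp j))
  hc1 := fun j => ((RapidDecay.finset_sum _ fun i _ =>
      (((Q.hp j).freqDeriv i).compLeft _).add ((P.hp i).sconv ((Q.hp j).freqDeriv i))).add
        ((Q.hp0.compLeft _).add ((P.hp j).sconv Q.hp0))).add ((P.hp0.compRight _).add (P.hp0.sconv (Q.hp j)))
  hc0 := (RapidDecay.finset_sum _ fun i _ =>
      ((Q.hp0.freqDeriv i).compLeft _).add ((P.hp i).sconv (Q.hp0.freqDeriv i))).add (P.hp0.sconv Q.hp0)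

/-- **The symbol of a composition is the composition of the symbols**:
`σ_{PQ}(k) = σ_P(k) ∘ σ_Q(k)` (Warner 6.28). [cite: WarnerGTM94, 6.28] -/
theorem symbol_comp (k : d → ℤ) : (P.comp Q).symbol k = (P.symbol k).comp (Q.symbol k) := by
  ext v
  simp only [POp.symbol, comp, symbol, ContinuousLinearMap.comp_apply, _root_.sum_apply, _root_.smul_apply,
    map_sum, map_smul, Finset.smul_sum, smul_smul]
  rw [Finset.sum_comm]
  exact Finset.sum_congr rfl fun a _ => Finset.sum_congr rfl fun b _ => by rw [mul_comm]

variable [CompleteSpace W] [CompleteSpace X]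

/-- **Composition computes the composite**: `(P ∘ Q) u = P (Q u)` for tempered `u`
(Warner 6.24; the Leibniz rule `∂_i (q ⋆ g) = (∂_i q) ⋆ g + q ⋆ ∂_i g`, the associativity
`p ⋆ (q ⋆ g) = (p ⋆ q) ⋆ g`, and linearity). [cite: WarnerGTM94, 6.24] -/
theorem apply_comp {u : (d → ℤ) → V} (hu : Tempered u) : (P.comp Q).apply u = P.apply (Q.apply u) := by
  -- abbreviations for the derivatives of `u`
  have hu1 : ∀ j, Tempered (freqDeriv j u) := fun j => hu.freqDeriv j
  have hu2 : ∀ i j, Tempered (freqDeriv i (freqDeriv j u)) := fun i j => hu.freqDeriv_freqDeriv i j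
  -- Step 1: expand `Q u` and its derivatives
  have hQ : Q.apply u = (fun k => ∑ j, Q.P j (freqDeriv j u k)) + ∑ j, conv (Q.p j) (freqDeriv j u) + conv Q.p0 u :=
    Q.apply_def u
  have hQt : Tempered (Q.apply u) := Q.tempered_apply hu
  have hG1 : ∀ i, freqDeriv i (fun k => ∑ j, Q.P j (freqDeriv j u k)) =
      fun k => ∑ j, Q.P j (freqDeriv i (freqDeriv j u) k) := fun i => by
    funext k; simp [Finset.smul_sum, smul_smul, mul_comm]
  have hG2 : ∀ i, freqDeriv i (∑ j, conv (Q.p j) (freqDeriv j u)) =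
      ∑ j, (conv (freqDeriv i (Q.p j)) (freqDeriv j u) + conv (Q.p j) (freqDeriv i (freqDeriv j u))) := fun i => by
    rw [freqDeriv_finset_sum]
    exact Finset.sum_congr rfl fun j _ => freqDeriv_conv (Q.hp j) (hu1 j) i
  have hG3 : ∀ i, freqDeriv i (conv Q.p0 u) = conv (freqDeriv i Q.p0) u + conv Q.p0 (freqDeriv i u) := fun i =>
    freqDeriv_conv Q.hp0 hu i
  have hDQ : ∀ i, freqDeriv i (Q.apply u) = (fun k => ∑ j, Q.P j (freqDeriv i (freqDeriv j u) k)) +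
      ∑ j, (conv (freqDeriv i (Q.p j)) (freqDeriv j u) + conv (Q.p j) (freqDeriv i (freqDeriv j u))) +
      (conv (freqDeriv i Q.p0) u + conv Q.p0 (freqDeriv i u)) := fun i => by
    rw [hQ, freqDeriv_add, freqDeriv_add, hG1, hG2, hG3]
  -- temperedness of the pieces
  have ht1 : ∀ i, Tempered (fun k => ∑ j, Q.P j (freqDeriv i (freqDeriv j u) k)) := fun i => by
    have : (fun k => ∑ j, Q.P j (freqDeriv i (freqDeriv j u) k)) = ∑ j, fun k => Q.P j (freqDeriv i (freqDeriv j u) k) := by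
      funext k; simp [Finset.sum_apply]
    rw [this]; exact Tempered.finset_sum _ fun j _ => (hu2 i j).comp_apply _
  have ht2 : ∀ i j, Tempered (conv (freqDeriv i (Q.p j)) (freqDeriv j u) + conv (Q.p j) (freqDeriv i (freqDeriv j u))) :=
    fun i j => ((hu1 j).conv ((Q.hp j).freqDeriv i)).add ((hu2 i j).conv (Q.hp j))
  have ht3 : ∀ i, Tempered (conv (freqDeriv i Q.p0) u + conv Q.p0 (freqDeriv i u)) := fun i =>
    (hu.conv (Q.hp0.freqDeriv i)).add ((hu1 i).conv Q.hp0)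
  have ht4 : Tempered (fun k => ∑ j, Q.P j (freqDeriv j u k)) := by
    have : (fun k => ∑ j, Q.P j (freqDeriv j u k)) = ∑ j, fun k => Q.P j (freqDeriv j u k) := by
      funext k; simp [Finset.sum_apply]
    rw [this]; exact Tempered.finset_sum _ fun j _ => (hu1 j).comp_apply _
  have ht5 : ∀ j, Tempered (conv (Q.p j) (freqDeriv j u)) := fun j => (hu1 j).conv (Q.hp j)
  -- Step 2: expand `P (Q u)` and push `conv`/constant maps inside all sums
  have hP : P.apply (Q.apply u) = (fun k => ∑ i, P.P i (freqDeriv i (Q.apply u) k)) +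
      ∑ i, conv (P.p i) (freqDeriv i (Q.apply u)) + conv P.p0 (Q.apply u) := P.apply_def _
  -- elementary rewriting lemmas
  have eA : ∀ i, (fun k => P.P i (freqDeriv i (Q.apply u) k)) =
      (fun k => ∑ j, (P.P i).comp (Q.P j) (freqDeriv i (freqDeriv j u) k)) +
      ∑ j, (conv (compLeft (P.P i) (freqDeriv i (Q.p j))) (freqDeriv j u) +
        conv (compLeft (P.P i) (Q.p j)) (freqDeriv i (freqDeriv j u))) +
      (conv (compLeft (P.P i) (freqDeriv i Q.p0)) u + conv (compLeft (P.P i) Q.p0) (freqDeriv i u)) := fun i => by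
    rw [hDQ i]
    rw [← comp_conv (P.P i) (Q.hp0.freqDeriv i) hu, ← comp_conv (P.P i) Q.hp0 (hu1 i)]
    have hin : ∀ j, conv (compLeft (P.P i) (freqDeriv i (Q.p j))) (freqDeriv j u) +
        conv (compLeft (P.P i) (Q.p j)) (freqDeriv i (freqDeriv j u)) =
        (fun k => P.P i (conv (freqDeriv i (Q.p j)) (freqDeriv j u) k)) +
          fun k => P.P i (conv (Q.p j) (freqDeriv i (freqDeriv j u)) k) := fun j => by
      rw [← comp_conv (P.P i) ((Q.hp j).freqDeriv i) (hu1 j), ← comp_conv (P.P i) (Q.hp j) (hu2 i j)]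
    simp only [hin]
    funext k
    simp only [Pi.add_apply, Finset.sum_apply, map_add, map_sum, ContinuousLinearMap.comp_apply]
  have eB : ∀ i, conv (P.p i) (freqDeriv i (Q.apply u)) =
      ∑ j, conv (compRight (P.p i) (Q.P j)) (freqDeriv i (freqDeriv j u)) +
      ∑ j, (conv (sconv (P.p i) (freqDeriv i (Q.p j))) (freqDeriv j u) +
        conv (sconv (P.p i) (Q.p j)) (freqDeriv i (freqDeriv j u))) +
      (conv (sconv (P.p i) (freqDeriv i Q.p0)) u + conv (sconv (P.p i) Q.p0) (freqDeriv i u)) := fun i => by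
    rw [hDQ i, conv_add (P.hp i) ((ht1 i).add (Tempered.finset_sum _ fun j _ => ht2 i j)) (ht3 i),
      conv_add (P.hp i) (ht1 i) (Tempered.finset_sum _ fun j _ => ht2 i j),
      conv_add (P.hp i) (hu.conv (Q.hp0.freqDeriv i)) ((hu1 i).conv Q.hp0),
      conv_conv (P.hp i) (Q.hp0.freqDeriv i) hu, conv_conv (P.hp i) Q.hp0 (hu1 i),
      conv_finset_sum _ (P.hp i) (fun j _ => ht2 i j)]
    have h1 : conv (P.p i) (fun k => ∑ j, Q.P j (freqDeriv i (freqDeriv j u) k)) =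
        ∑ j, conv (compRight (P.p i) (Q.P j)) (freqDeriv i (freqDeriv j u)) := by
      have : (fun k => ∑ j, Q.P j (freqDeriv i (freqDeriv j u) k)) = ∑ j, fun k => Q.P j (freqDeriv i (freqDeriv j u) k) := by
        funext k; simp [Finset.sum_apply]
      rw [this, conv_finset_sum _ (P.hp i) (fun j _ => (hu2 i j).comp_apply _)]
      rfl
    have h2 : ∀ j, conv (P.p i) (conv (freqDeriv i (Q.p j)) (freqDeriv j u) + conv (Q.p j) (freqDeriv i (freqDeriv j u))) =
        conv (sconv (P.p i) (freqDeriv i (Q.p j))) (freqDeriv j u) +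
          conv (sconv (P.p i) (Q.p j)) (freqDeriv i (freqDeriv j u)) := fun j => by
      rw [conv_add (P.hp i) ((hu1 j).conv ((Q.hp j).freqDeriv i)) ((hu2 i j).conv (Q.hp j)),
        conv_conv (P.hp i) ((Q.hp j).freqDeriv i) (hu1 j), conv_conv (P.hp i) (Q.hp j) (hu2 i j)]
    rw [h1]
    simp only [h2]
  have eC : conv P.p0 (Q.apply u) = ∑ j, conv (compRight P.p0 (Q.P j)) (freqDeriv j u) +
      ∑ j, conv (sconv P.p0 (Q.p j)) (freqDeriv j u) + conv (sconv P.p0 Q.p0) u := by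
    rw [hQ, conv_add P.hp0 (ht4.add (Tempered.finset_sum _ fun j _ => ht5 j)) (hu.conv Q.hp0),
      conv_add P.hp0 ht4 (Tempered.finset_sum _ fun j _ => ht5 j), conv_conv P.hp0 Q.hp0 hu,
      conv_finset_sum _ P.hp0 (fun j _ => ht5 j)]
    have h1 : conv P.p0 (fun k => ∑ j, Q.P j (freqDeriv j u k)) = ∑ j, conv (compRight P.p0 (Q.P j)) (freqDeriv j u) := by
      have : (fun k => ∑ j, Q.P j (freqDeriv j u k)) = ∑ j, fun k => Q.P j (freqDeriv j u k) := by
        funext k; simp [Finset.sum_apply]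
      rw [this, conv_finset_sum _ P.hp0 (fun j _ => (hu1 j).comp_apply _)]
      rfl
    rw [h1]
    simp only [fun j => conv_conv P.hp0 (Q.hp j) (hu1 j)]
  -- Step 3: expand the left-hand side
  have hL : (P.comp Q).apply u = (P.comp Q).principal u + (P.comp Q).lower u := (P.comp Q).apply_def u
  have hLp : (P.comp Q).principal u = fun k => ∑ i, ∑ j, (P.P i).comp (Q.P j) (freqDeriv i (freqDeriv j u) k) := by
    funext k; simp [POp.principal, comp]
  have hLl : (P.comp Q).lower u =
      ∑ i, ∑ j, (conv (compLeft (P.P i) (Q.p j)) (freqDeriv i (freqDeriv j u)) +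
        conv (compRight (P.p i) (Q.P j)) (freqDeriv i (freqDeriv j u)) +
        conv (sconv (P.p i) (Q.p j)) (freqDeriv i (freqDeriv j u))) +
      ∑ j, (∑ i, (conv (compLeft (P.P i) (freqDeriv i (Q.p j))) (freqDeriv j u) +
          conv (sconv (P.p i) (freqDeriv i (Q.p j))) (freqDeriv j u)) +
        (conv (compLeft (P.P j) Q.p0) (freqDeriv j u) + conv (sconv (P.p j) Q.p0) (freqDeriv j u)) +
        (conv (compRight P.p0 (Q.P j)) (freqDeriv j u) + conv (sconv P.p0 (Q.p j)) (freqDeriv j u))) +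
      (∑ i, (conv (compLeft (P.P i) (freqDeriv i Q.p0)) u + conv (sconv (P.p i) (freqDeriv i Q.p0)) u) +
        conv (sconv P.p0 Q.p0) u) := by
    rw [(P.comp Q).lower_def u]
    simp only [comp]
    congr 1
    · congr 1
      · refine Finset.sum_congr rfl fun i _ => Finset.sum_congr rfl fun j _ => ?_
        rw [add_conv (((Q.hp j).compLeft _).add ((P.hp i).compRight _)) ((P.hp i).sconv (Q.hp j)) (hu2 i j),
          add_conv ((Q.hp j).compLeft _) ((P.hp i).compRight _) (hu2 i j)]
      · refine Finset.sum_congr rfl fun j _ => ?_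
        have hs : ∀ i, RapidDecay (compLeft (P.P i) (freqDeriv i (Q.p j)) + sconv (P.p i) (freqDeriv i (Q.p j))) :=
          fun i => (((Q.hp j).freqDeriv i).compLeft _).add ((P.hp i).sconv ((Q.hp j).freqDeriv i))
        rw [add_conv ((RapidDecay.finset_sum _ fun i _ => hs i).add ((Q.hp0.compLeft _).add ((P.hp j).sconv Q.hp0)))
            ((P.hp0.compRight _).add (P.hp0.sconv (Q.hp j))) (hu1 j),
          add_conv (RapidDecay.finset_sum _ fun i _ => hs i) ((Q.hp0.compLeft _).add ((P.hp j).sconv Q.hp0)) (hu1 j),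
          finset_sum_conv _ (fun i _ => hs i) (hu1 j),
          add_conv (Q.hp0.compLeft _) ((P.hp j).sconv Q.hp0) (hu1 j),
          add_conv (P.hp0.compRight _) (P.hp0.sconv (Q.hp j)) (hu1 j)]
        congr 1; congr 1
        exact Finset.sum_congr rfl fun i _ => add_conv (((Q.hp j).freqDeriv i).compLeft _)
          ((P.hp i).sconv ((Q.hp j).freqDeriv i)) (hu1 j)
    · have hs : ∀ i, RapidDecay (compLeft (P.P i) (freqDeriv i Q.p0) + sconv (P.p i) (freqDeriv i Q.p0)) :=
        fun i => ((Q.hp0.freqDeriv i).compLeft _).add ((P.hp i).sconv (Q.hp0.freqDeriv i))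
      rw [add_conv (RapidDecay.finset_sum _ fun i _ => hs i) (P.hp0.sconv Q.hp0) hu,
        finset_sum_conv _ (fun i _ => hs i) hu]
      congr 1
      exact Finset.sum_congr rfl fun i _ => add_conv ((Q.hp0.freqDeriv i).compLeft _)
        ((P.hp i).sconv (Q.hp0.freqDeriv i)) hu
  -- Step 4: compare pointwise
  have hPA : (fun k => ∑ i, P.P i (freqDeriv i (Q.apply u) k)) = ∑ i, fun k => P.P i (freqDeriv i (Q.apply u) k) := by
    funext k; simp [Finset.sum_apply]
  rw [hL, hLp, hLl, hP, hPA, eC]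
  simp only [eA, eB]
  funext k
  simp only [Pi.add_apply, Finset.sum_apply, Finset.sum_add_distrib]
  rw [Finset.sum_comm (f := fun j i => conv (compLeft (P.P i) (freqDeriv i (Q.p j))) (freqDeriv j u) k),
    Finset.sum_comm (f := fun j i => conv (sconv (P.p i) (freqDeriv i (Q.p j))) (freqDeriv j u) k)]
  abel

/-! ### Smallness of the principal perturbation of a composition -/

/-- **Level-`0` smallness propagates through composition**: if the perturbation symbols of `P`
and `Q` satisfy `‖p_i ⋆ c‖_0 ≤ ε_P‖c‖_0`, `‖q_j ⋆ c‖_0 ≤ ε_Q‖c‖_0`, then those of `P ∘ Q` satisfy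
`‖b_{ij} ⋆ c‖_0 ≤ (‖P_i‖ ε_Q + ε_P ‖Q_j‖ + ε_P ε_Q) ‖c‖_0`. [folklore] -/
theorem principalPerturbationLE_comp {εP εQ : ℝ≥0∞}
    (hp : ∀ i (c : (d → ℤ) → W), eNormSq 0 c < ∞ → eNorm 0 (conv (P.p i) c) ≤ εP * eNorm 0 c)
    (hq : ∀ j (c : (d → ℤ) → V), eNormSq 0 c < ∞ → eNorm 0 (conv (Q.p j) c) ≤ εQ * eNorm 0 c)
    (MP MQ : ℝ≥0∞) (hMP : ∀ i, ‖P.P i‖ₑ ≤ MP) (hMQ : ∀ j, ‖Q.P j‖ₑ ≤ MQ) :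
    (P.comp Q).PrincipalPerturbationLE (MP * εQ + εP * MQ + εP * εQ) := by
  intro i j c hc
  have hct : Tempered c := ⟨0, hc⟩
  have h1 : eNorm 0 (conv (compLeft (P.P i) (Q.p j)) c) ≤ MP * εQ * eNorm 0 c := by
    rw [← comp_conv (P.P i) (Q.hp j) hct]
    calc eNorm 0 (fun k => P.P i (conv (Q.p j) c k)) ≤ ‖P.P i‖ₑ * eNorm 0 (conv (Q.p j) c) := eNorm_comp_apply_le 0 _ _
      _ ≤ MP * (εQ * eNorm 0 c) := mul_le_mul' (hMP i) (hq j c hc)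
      _ = _ := by ring
  have h2 : eNorm 0 (conv (compRight (P.p i) (Q.P j)) c) ≤ εP * MQ * eNorm 0 c := by
    rw [← conv_comp]
    have hc' : eNormSq 0 (fun k => Q.P j (c k)) < ∞ :=
      (eNormSq_comp_apply_le 0 _ c).trans_lt (ENNReal.mul_lt_top (ENNReal.pow_lt_top enorm_lt_top) hc)
    calc eNorm 0 (conv (P.p i) fun k => Q.P j (c k)) ≤ εP * eNorm 0 (fun k => Q.P j (c k)) := hp i _ hc'
      _ ≤ εP * (‖Q.P j‖ₑ * eNorm 0 c) := mul_le_mul' le_rfl (eNorm_comp_apply_le 0 _ _)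
      _ ≤ εP * (MQ * eNorm 0 c) := by gcongr; exact hMQ j
      _ = _ := by ring
  have h3 : eNorm 0 (conv (sconv (P.p i) (Q.p j)) c) ≤ εP * εQ * eNorm 0 c := by
    rw [← conv_conv (P.hp i) (Q.hp j) hct]
    have hc' : eNormSq 0 (conv (Q.p j) c) < ∞ := eNormSq_conv_lt_top (Q.hp j) hc
    calc eNorm 0 (conv (P.p i) (conv (Q.p j) c)) ≤ εP * eNorm 0 (conv (Q.p j) c) := hp i _ hc'
      _ ≤ εP * (εQ * eNorm 0 c) := mul_le_mul' le_rfl (hq j c hc)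
      _ = _ := by ring
  have hsplit : conv ((P.comp Q).b i j) c = conv (compLeft (P.P i) (Q.p j)) c + conv (compRight (P.p i) (Q.P j)) c +
      conv (sconv (P.p i) (Q.p j)) c := by
    show conv (compLeft (P.P i) (Q.p j) + compRight (P.p i) (Q.P j) + sconv (P.p i) (Q.p j)) c = _
    rw [add_conv (((Q.hp j).compLeft _).add ((P.hp i).compRight _)) ((P.hp i).sconv (Q.hp j)) hct,
      add_conv ((Q.hp j).compLeft _) ((P.hp i).compRight _) hct]
  calc eNorm 0 (conv ((P.comp Q).b i j) c)
      = eNorm 0 (conv (compLeft (P.P i) (Q.p j)) c + conv (compRight (P.p i) (Q.P j)) c +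
          conv (sconv (P.p i) (Q.p j)) c) := by rw [hsplit]
    _ ≤ eNorm 0 (conv (compLeft (P.P i) (Q.p j)) c) + eNorm 0 (conv (compRight (P.p i) (Q.P j)) c) +
          eNorm 0 (conv (sconv (P.p i) (Q.p j)) c) := (eNorm_add_le 0 _ _).trans (add_le_add (eNorm_add_le 0 _ _) le_rfl)
    _ ≤ MP * εQ * eNorm 0 c + εP * MQ * eNorm 0 c + εP * εQ * eNorm 0 c := add_le_add (add_le_add h1 h2) h3
    _ = _ := by ring

end POp1

end Lattice

end Literature.Analysis.FunctionSpaces
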